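import Literature.Probability.LatticeModels.FKIsingInterfaceIdentificationProofs
import Literature.Probability.RandomPlanarGeometry.ObservableDiscretePassage
import Literature.Probability.RandomPlanarGeometry.DrivingFunctionMeasurable
import Literature.Probability.Process.TailMoments
import HarnessLib

/-!
# FK-Ising interfaces and SLE_{16/3}: the identification step from its two printed inputs

Topic `Literature/Probability/LatticeModels` (family `crit-ising`); theorems only. This file
assembles, for ONE subsequential limit law `μ` and ONE chordal uniformizing map `φ` of the
Dobrushin domain `(D; a, b)`, the whole identification half of the proof of
Chelkak–Duminil-Copin–Hongler–Kemppainen–Smirnov's Theorem 2 (C. R. Math. 352 (2014); written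
out in Duminil-Copin–Smirnov, Clay Math. Proc. 15 (2012), §6, proof of Prop. 6.7) from the two
inputs the printed proof quotes, in the exact shapes the tree's proved reductions consume:

* **(J) Kemppainen–Smirnov** (CDHKS Thm. 3 = Kemppainen–Smirnov 2017, Thm. 1.5 and Cor. 1.7
  with the crossing bounds of CDHKS Thm. 4): `μ`-a.e. curve class is describable by the Loewner
  evolution through `φ` (`IsLoewnerDescribable`) and starts at `a`; the capacity driving
  processes `V^k` of the discrete interfaces converge in distribution in `C([0, ∞), ℝ)` to the
  driving function of the limit (`drivingFunction φ`, a Borel function of the curve: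
  `DrivingFunctionMeasurable.lean`); and the running maxima `sup_{u ≤ t} |V^k_u|` have
  eventually-uniform sub-exponential tails (Kemppainen–Smirnov 2017, Prop. 3.8, eq. (19) of
  arXiv:1212.6215: `P(sup_{s ≤ t} |W_s| > b) ≤ K e^{-c b/√t}` uniformly over the family);
* **(D) Duminil-Copin–Smirnov / Smirnov** (DCS Lemma 6.6: the discrete fermionic observable of
  the explored slit domain is a martingale for the exploration filtration; DCS Thm. 3.15 =
  Smirnov, Ann. Math. 172 (2010), Thm. 2.2, uniformly over the slit domains): at every scale a
  discrete filtration, a complex martingale and stopping times whose stopped values approximate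
  the time-limited observable `N^y_u(V^k)` — literally the hypothesis `hD` of the tree's PROVED
  passage theorem `Loewner.integral_observableProcess_cylinder_eq_zero_of_discreteMartingales`
  (`RandomPlanarGeometry/ObservableDiscretePassage.lean`).

Results (all PROVED; no definition, no named fact):

* `isSLELaw_sixteen_thirds_of_cylinderIdentity` — **CDHKS §3 as one theorem, locally**: a
  probability measure `μ` on curve classes carrying a process `W` with measurable marginals,
  continuous paths, `W 0 = 0`, `L³` running maxima, `μ`-a.e. driving the curve through `φ`, and
  satisfying the observable martingale identity against cylinder functionals — the
  *cylinder-identity data* (M5′) of CDHKS §3 for `(μ, φ)` ("`M_t(z)`, `t ≤ T(z)`, is a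
  martingale with respect to the filtration generated by `W_t`", in monotone-class form) — IS
  the chordal SLE_{16/3} law of `(D; a, b)` (monotone class ⟹ natural-filtration martingales ⟹
  optional stopping ⟹ far-field expansion: `W_t`, `W_t² - (16/3)t` martingales ⟹ Lévy ⟹
  Brownian coupling ⟹ Rohde–Schramm at `κ = 16/3`; every arrow a theorem of the tree);
* `exists_cylinderIdentityData_of_limitData` — **(J) ∧ (D) ⟹ the cylinder-identity data (M5′)
  for `(μ, φ)`**,
  with the driving process `W c = drivingFunction φ c` (set to `0` on the null set of curves not
  starting at `a`, so that `W c 0 = 0` surely): measurability by `measurable_drivingFunction`,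
  the `L³` clause by `Process.exists_memLp_forall_abs_le_of_tendstoInDistribution`
  (`Process/TailMoments.lean`), the cylinder identity by the passage theorem;
* `isSLELaw_sixteen_thirds_of_limitData` — **(J) ∧ (D) ⟹ `IsSLELaw (16/3) D μ`**;
* `exists_naturalObservableMartingale_fkInterface_of_limitData`,
  `exists_observableMartingale_fkInterface_of_limitData`,
  `isSLELaw_of_isSubseqLimitLaw_fkInterfaceCurve_of_limitData`,
  `convergesInLawToSLE_sixteen_thirds_fkInterface_of_traversalBound_of_limitData` — the global
  forms: if (J) ∧ (D) hold for every discretised Dobrushin domain, every subsequential limit law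
  of the critical FK-Ising interfaces and every chordal uniformizing map, then: the literal
  sentence (M5) of CDHKS §3 holds (real and imaginary parts of the time-limited observable are
  martingales in the natural filtration of a version of the driving process), the layer-4 named
  fact (L‴) `exists_observableMartingale_fkInterface` (`FKIsingObservableMartingale.lean`) and
  the identification fact (L) `isSLELaw_of_isSubseqLimitLaw_fkInterfaceCurve`
  (`FKIsingInterfaceSLE.lean`) hold, and — with the FK traversal bound (C1)
  `fkInterface_traversalBound` — so does crit-ising.S17 (FK)
  `convergesInLawToSLE_sixteen_thirds_fkInterface` itself.

So the named-fact-free frontier of (L) (and, with the traversal bound (C1), of crit-ising.S17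
FK) is exactly the pair (J), (D) above, as theorem hypotheses. **D-0026 review (2026-08-15).**
The cylinder-identity data (M5′) were for a while vendored as a closed named fact
`exists_cylinderObservableIdentity_fkInterface` (`FKIsingNaturalMartingale.lean`); the bad-split
review found it to be a step of the parent's own printed proof (the displayed claim of CDHKS §3 =
one sentence of DCS p. 29, "Since the convergence is uniform, `M_t(z') := lim M^δ_{τ_t}(z')` is a
martingale"), one proved lemma (`exists_cylinderIdentityData_of_limitData`) above the conjunction
of two distinct published theorems the tree does not yet hold — Kemppainen–Smirnov 2017,
Thm. 1.5 with Cor. 1.7 (arXiv Thm. 1.3, Cor. 1.5; FK case via Prop. 4.3) and Smirnov 2010,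
Thm. 2.2 = DCS Thm. 3.15 in its Carathéodory-uniform form — and merged it back into the parent's
proof obligation: it lives on as the hypotheses `hcyl` / `h` of the theorems of this file, not as
literature debt.

## References

* D. Chelkak, H. Duminil-Copin, C. Hongler, A. Kemppainen, S. Smirnov, *Convergence of Ising
  interfaces to Schramm's SLE curves*, C. R. Math. Acad. Sci. Paris 352 (2014) 157–161
  (arXiv:1312.0533): Thm. 2, Thm. 3, Thm. 4, §3.
* H. Duminil-Copin, S. Smirnov, *Conformal invariance of lattice models*, Clay Math. Proc. 15
  (2012) 213–276 (arXiv:1109.1549): Thm. 6.4, Lemma 6.6, Thm. 3.15, Prop. 6.7 and its proof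
  (p. 29).
* A. Kemppainen, S. Smirnov, *Random curves, scaling limits and Loewner evolutions*, Ann.
  Probab. 45 (2017) 698–779 (arXiv:1212.6215): Thm. 1.5, Cor. 1.7, Prop. 3.8.
* S. Smirnov, *Conformal invariance in random cluster models. I*, Ann. Math. 172 (2010),
  Thm. 2.2.
-/

noncomputable section

open MeasureTheory ProbabilityTheory Filter Topology Set
open UpperHalfPlane (upperHalfPlaneSet)
open scoped NNReal ENNReal
open Literature.Probability.RandomPlanarGeometry Literature.Probability.LatticeModels
  Literature.Probability.Percolation Literature.Probability.Process

namespace Literature.Probability.LatticeModels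

open RandomPlanarGeometry.Loewner
open scoped Literature.Probability.RandomPlanarGeometry.PathBorel

/-! ### CDHKS §3 as one theorem: the cylinder identity identifies SLE_{16/3} -/

/-- **The observable martingale identity identifies chordal SLE_{16/3} (local form of the
layers 2–5 of the tree's decomposition of CDHKS Thm. 2).** Let `φ` be a chordal uniformizing map
of the Dobrushin domain `(D; a, b)`, `μ` a probability measure on curve classes and
`W : CurveClass ℂ → ([0, ∞) → ℝ)` a process with strongly measurable marginals, continuous paths,
`W 0 = 0`, running maxima dominated by nonnegative `L³(μ)` functions, `μ`-a.e. driving the curve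
through `φ`, and such that for every `y > 0` the time-limited FK observable process
`N^y = observableProcess W y` satisfies `E_μ[(N^y_t - N^y_s) ψ(W_S)] = 0` for all `s ≤ t`, all
finite families of times `S ≤ s` and all continuous `|ψ| ≤ 1`. Then `μ` is the chordal SLE_{16/3}
law of `(D; a, b)`. Chain (all proved in the tree): cylinder identity ⟹ `Re/Im N^y` martingales in
the natural filtration of `W` (`martingale_re_im_observableProcess_of_cylinder`) ⟹ stopped
observables are martingales (`Loewner.martingale_re/im_stoppedObservable`) ⟹ `W_t` and
`W_t² - (16/3)t` are martingales (`Loewner.martingale_driver_of_fkObservable`, the far-field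
expansion of CDHKS eq. (5)) ⟹ Brownian coupling by Lévy's characterisation
(`exists_isSLEDrivingCoupling_of_isLocalMartingale_driving`) ⟹ SLE_{16/3} law
(`isSLELaw_sixteen_thirds_of_isSLEDrivingCoupling`, Rohde–Schramm at `κ = 16/3`). This is the
argument of CDHKS (2014), §3 / Duminil-Copin–Smirnov (2012), proof of Prop. 6.7, for one
subsequential limit. [cite: CDHKSCRAS2014, §3] [cite: DuminilCopinSmirnov2012Clay, Prop. 6.7 (proof, p. 29)] -/
theorem isSLELaw_sixteen_thirds_of_cylinderIdentity {D : DobrushinDomain}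
    {φ : ConformalEquiv upperHalfPlaneSet D.carrier} (hφ : D.IsChordalUniformizing φ)
    {μ : Measure (CurveClass ℂ)} [IsProbabilityMeasure μ] {W : CurveClass ℂ → ℝ≥0 → ℝ}
    (hW : ∀ t, StronglyMeasurable (fun c ↦ W c t)) (hWc : ∀ c, Continuous (W c))
    (hW0 : ∀ c, W c 0 = 0)
    (hmom : ∀ t : ℝ≥0, ∃ M : CurveClass ℂ → ℝ, MemLp M 3 μ ∧ (∀ c, 0 ≤ M c) ∧
      ∀ᵐ c ∂μ, ∀ u, u ≤ t → |W c u| ≤ M c)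
    (hdrv : ∀ᵐ c ∂μ, Loewner.IsDrivenBy φ.boundaryExtension (D.pt 1) (W c) c)
    (hcyl : ∀ y : ℝ, 0 < y → ∀ s t : ℝ≥0, s ≤ t → ∀ (n : ℕ) (S : Fin n → ℝ≥0), (∀ k, S k ≤ s) →
      ∀ ψ : (Fin n → ℝ) → ℝ, Continuous ψ → (∀ v, |ψ v| ≤ 1) →
        ∫ c, (observableProcess (fun t c ↦ W c t) y t c -
            observableProcess (fun t c ↦ W c t) y s c) * (ψ (fun k ↦ W c (S k)) : ℂ) ∂μ = 0) :
    IsSLELaw (16 / 3) D μ := by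
  -- natural-filtration martingales (monotone class)
  have hmart : ∀ y : ℝ, 0 < y →
      Martingale (fun t c ↦ (observableProcess (fun t c ↦ W c t) y t c).re)
        (Filtration.natural (fun t c ↦ W c t) hW) μ ∧
      Martingale (fun t c ↦ (observableProcess (fun t c ↦ W c t) y t c).im)
        (Filtration.natural (fun t c ↦ W c t) hW) μ := fun y hy ↦
    martingale_re_im_observableProcess_of_cylinder (W := fun t c ↦ W c t) hW hWc hy (hcyl y hy)
  -- optional stopping: the stopped observables are martingales
  set 𝓕 := Filtration.natural (fun t c ↦ W c t) hW with h𝓕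
  have hWad : StronglyAdapted 𝓕 (fun t c ↦ W c t) := Filtration.stronglyAdapted_natural hW
  have hobs : ∀ y : ℝ, 1 ≤ y →
      Martingale (fun t c ↦ (stoppedObservable (fun t c ↦ W c t) y t c).re) 𝓕 μ ∧
      Martingale (fun t c ↦ (stoppedObservable (fun t c ↦ W c t) y t c).im) 𝓕 μ := by
    intro y hy
    have hy0 : 0 < y := by linarith
    exact ⟨martingale_re_stoppedObservable hWad hWc hy0 (hmart y hy0).1,
      martingale_im_stoppedObservable hWad hWc hy0 (hmart y hy0).2⟩
  -- far-field expansion: `W_t` and `W_t² - (16/3) t` are martingales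
  obtain ⟨hM1, hM2⟩ := martingale_driver_of_fkObservable (W := fun t c ↦ W c t) hWad hWc hW0 hmom
    (fun y hy ↦ (hobs y hy).1) (fun y hy ↦ (hobs y hy).2)
  -- rescale into the local-martingale/quadratic-variation format
  set k : ℝ := (Real.sqrt ((16 / 3 : ℝ≥0) : ℝ))⁻¹ with hk
  have hX : Martingale (fun t c ↦ k * W c t) 𝓕 μ := by
    have : (fun t c ↦ k * W c t) = k • fun t c ↦ W c t := by ext t c; simp
    rw [this]; exact hM1.smul k
  have hX2 : Martingale (fun t c ↦ (k * W c t) ^ 2 - (t : ℝ)) 𝓕 μ := by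
    have : (fun t c ↦ (k * W c t) ^ 2 - (t : ℝ)) =
        ((16 / 3 : ℝ≥0) : ℝ)⁻¹ • fun t c ↦ W c t ^ 2 - 16 / 3 * (t : ℝ) := by
      ext t c
      simp only [Pi.smul_apply, smul_eq_mul]
      rw [mul_pow, hk, inv_sqrt_sixteen_thirds_sq]
      field_simp
      push_cast
      ring
    rw [this]; exact hM2.smul _
  have hQ : Process.HasQuadraticVariation (fun t c ↦ k * W c t) (fun t _ ↦ (t : ℝ)) 𝓕 μ :=
    { adapted := adapted_const' _ _
      continuous := ae_of_all _ fun _ ↦ NNReal.continuous_coe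
      monotone := ae_of_all _ fun _ _ _ h ↦ NNReal.coe_le_coe.2 h
      zero := fun _ ↦ rfl
      isLocalMartingale := hX2.isLocalMartingale }
  -- Lévy ⟹ Brownian coupling ⟹ SLE_{16/3} law
  obtain ⟨νc, hνc⟩ := exists_isSLEDrivingCoupling_of_isLocalMartingale_driving sixteen_thirds_pos φ
    (fun t ↦ (hW t).measurable) (ae_of_all _ hW0) (ae_of_all _ hWc) hX.isLocalMartingale hQ hdrv
  exact isSLELaw_sixteen_thirds_of_isSLEDrivingCoupling hφ hνc

/-! ### (J) ∧ (D) ⟹ the cylinder-identity data (M5′), for one limit law and one uniformizing map -/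

section LimitData

variable {D : DobrushinDomain} {φ : ConformalEquiv upperHalfPlaneSet D.carrier}
  {μ : Measure (CurveClass ℂ)} [IsProbabilityMeasure μ]
  {Ω' : ℕ → Type*} {mΩ' : ∀ k, MeasurableSpace (Ω' k)} {P : ∀ k, Measure (Ω' k)}
  [∀ k, IsProbabilityMeasure (P k)] {V : ∀ k, ℝ≥0 → Ω' k → ℝ}

/-- **The cylinder-identity data (M5′) for one subsequential limit, from the Kemppainen–Smirnov
data (J) and the discrete observable martingales (D).** Inputs, for a chordal uniformizing map `φ` of
`(D; a, b)` and a probability measure `μ` on curve classes (a subsequential limit of interface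
laws): (J) `μ`-a.e. curve class is describable by the Loewner evolution through `φ`
(Kemppainen–Smirnov 2017, Thm. 1.5 (iv)–(v); CDHKS Thm. 3 with Thm. 4) and starts at `a`; the
continuous-path processes `V^k` (the capacity driving processes of the discrete interfaces, on
their own probability spaces) converge in distribution in `C([0, ∞), ℝ)` to the driving function
of the limit (KS Cor. 1.7: "the limits agree in the sense that `γ = lim γₙ` is driven by
`W = lim Wₙ`"); for every `t` the running maxima `sup_{u ≤ t} |V^k_u|` have eventually-uniform
sub-exponential tails at integer levels (KS Prop. 3.8, eq. (19)); and (D) the discrete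
observable martingale data of `Loewner.integral_observableProcess_cylinder_eq_zero_of_discreteMartingales`
for every `y > 0` (DCS Lemma 6.6 and Thm. 3.15 = Smirnov 2010, Thm. 2.2). Output: a process `W`
on `(CurveClass ℂ, μ)` with all six clauses of the cylinder-identity data of CDHKS §3 (the
hypotheses of `isSLELaw_sixteen_thirds_of_cylinderIdentity`) — namely `W c = drivingFunction φ c` for curves from `a` and `0` otherwise. PROVED
(`measurable_drivingFunction`, `drivingFunction_apply_zero`,
`Process.exists_memLp_forall_abs_le_of_tendstoInDistribution`, the passage theorem).
[cite: CDHKSCRAS2014, Thm. 3 and §3] [cite: DuminilCopinSmirnov2012Clay, Thm. 6.4, Lemma 6.6 and proof of Prop. 6.7 (p. 29)] -/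
theorem exists_cylinderIdentityData_of_limitData (hφ : D.IsChordalUniformizing φ)
    (hdesc : ∀ᵐ c ∂μ, IsLoewnerDescribable φ c) (hsrc : ∀ᵐ c ∂μ, c.source = D.pt 0)
    (hVc : ∀ k ω, Continuous (V k · ω))
    (hlaw : TendstoInDistribution (fun k ω ↦ (⟨fun u ↦ V k u ω, hVc k ω⟩ : C(ℝ≥0, ℝ))) atTop
      (fun c ↦ (⟨drivingFunction φ c, continuous_drivingFunction φ c⟩ : C(ℝ≥0, ℝ))) P μ)
    (htail : ∀ t : ℝ≥0, ∃ (K r : ℝ) (n₀ : ℕ), 0 < r ∧ ∀ n : ℕ, n₀ ≤ n →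
      ∀ᶠ k in atTop, P k {ω | ∃ u, u ≤ t ∧ (n : ℝ) < |V k u ω|} ≤
        ENNReal.ofReal (K * Real.exp (-r * n)))
    (hD : ∀ y : ℝ, 0 < y → ∀ s t : ℝ≥0, s < t → t < cdhksTime y →
      ∃ (C' : ℝ) (ε Δ η : ℕ → ℝ≥0), Tendsto ε atTop (𝓝 0) ∧ Tendsto Δ atTop (𝓝 0) ∧
        Tendsto η atTop (𝓝 0) ∧
        ∀ k, ∃ (𝒢 : Filtration ℕ (mΩ' k)) (F : ℕ → Ω' k → ℂ) (σ τ : Ω' k → WithTop ℕ)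
          (hσ : IsStoppingTime 𝒢 σ) (M : ℕ) (bad : Set (Ω' k)),
          IsStoppingTime 𝒢 τ ∧ Martingale F 𝒢 (P k) ∧ σ ≤ τ ∧ (∀ ω, τ ω ≤ M) ∧
          (∀ u, u ≤ s → Measurable[hσ.measurableSpace] (V k u)) ∧
          (∀ᵐ ω ∂P k, ‖stoppedValue F σ ω‖ ≤ C') ∧ (∀ᵐ ω ∂P k, ‖stoppedValue F τ ω‖ ≤ C') ∧
          MeasurableSet bad ∧ P k bad ≤ η k ∧
          ∀ᵐ ω ∂P k, ω ∉ bad →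
            (∃ u ∈ Icc s (s + Δ k), ‖stoppedValue F σ ω - observableProcess (V k) y u ω‖ ≤ ε k) ∧
            (∃ u ∈ Icc t (t + Δ k), ‖stoppedValue F τ ω - observableProcess (V k) y u ω‖ ≤ ε k)) :
    ∃ W : CurveClass ℂ → ℝ≥0 → ℝ,
      (∀ t, StronglyMeasurable (fun c ↦ W c t)) ∧ (∀ c, Continuous (W c)) ∧ (∀ c, W c 0 = 0) ∧
      (∀ t : ℝ≥0, ∃ M : CurveClass ℂ → ℝ, MemLp M 3 μ ∧ (∀ c, 0 ≤ M c) ∧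
        ∀ᵐ c ∂μ, ∀ u, u ≤ t → |W c u| ≤ M c) ∧
      (∀ᵐ c ∂μ, Loewner.IsDrivenBy φ.boundaryExtension (D.pt 1) (W c) c) ∧
      ∀ y : ℝ, 0 < y → ∀ s t : ℝ≥0, s ≤ t → ∀ (n : ℕ) (S : Fin n → ℝ≥0), (∀ k, S k ≤ s) →
        ∀ ψ : (Fin n → ℝ) → ℝ, Continuous ψ → (∀ v, |ψ v| ≤ 1) →
          ∫ c, (observableProcess (fun t c ↦ W c t) y t c -
              observableProcess (fun t c ↦ W c t) y s c) * (ψ (fun k ↦ W c (S k)) : ℂ) ∂μ = 0 := by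
  classical
  -- the driving function, zeroed on the (null) set of curves not starting at `a`
  set W : CurveClass ℂ → ℝ≥0 → ℝ :=
    fun c t ↦ if c.source = D.pt 0 then drivingFunction φ c t else 0 with hWdef
  have hWeq : ∀ {c : CurveClass ℂ}, c.source = D.pt 0 → W c = drivingFunction φ c := by
    intro c hc
    funext t
    simp [hWdef, hc]
  have hWae : ∀ᵐ c ∂μ, W c = drivingFunction φ c := by
    filter_upwards [hsrc] with c hc
    exact hWeq hc
  have hWm : ∀ t, StronglyMeasurable (fun c ↦ W c t) := fun t ↦
    (Measurable.ite (CurveClass.isClosed_setOf_source_eq (D.pt 0)).measurableSet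
      (measurable_drivingFunction_apply hφ t) measurable_const).stronglyMeasurable
  have hWc : ∀ c, Continuous (W c) := by
    intro c
    by_cases hc : c.source = D.pt 0
    · rw [hWeq hc]
      exact continuous_drivingFunction φ c
    · have : W c = 0 := by
        funext t
        simp [hWdef, hc]
      rw [this]
      exact continuous_const
  have hW0 : ∀ c, W c 0 = 0 := by
    intro c
    by_cases hc : c.source = D.pt 0
    · rw [hWeq hc]
      exact drivingFunction_apply_zero hφ hc
    · simp [hWdef, hc]
  -- convergence in distribution to the paths of `W`
  have hlaw' : TendstoInDistribution (fun k ω ↦ (⟨fun u ↦ V k u ω, hVc k ω⟩ : C(ℝ≥0, ℝ))) atTop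
      (fun c ↦ (⟨fun u ↦ W c u, hWc c⟩ : C(ℝ≥0, ℝ))) P μ := by
    refine hlaw.congr (fun k ↦ EventuallyEq.rfl) ?_
    filter_upwards [hWae] with c hc
    ext u
    simp [hc]
  refine ⟨W, hWm, hWc, hW0, fun t ↦ ?_, ?_, fun y hy ↦ ?_⟩
  · -- the `L³` running maximum
    obtain ⟨K, r, n₀, hr, htail_t⟩ := htail t
    obtain ⟨M, hM, hM0, hbd⟩ :=
      exists_memLp_forall_abs_le_of_tendstoInDistribution (W := fun t c ↦ W c t) (fun c ↦ hWc c)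
        hVc hlaw' t 3 hr n₀ htail_t
    refine ⟨M, ?_, hM0, ae_of_all _ fun c u hu ↦ hbd c u hu⟩
    simpa using hM
  · -- a.e. the curve is driven by `W c`
    filter_upwards [hdesc, hsrc] with c hd hs
    rw [hWeq hs]
    exact (isLoewnerDescribed_drivingFunction hd).2
  · -- the cylinder identity, by the passage theorem
    exact integral_observableProcess_cylinder_eq_zero_of_discreteMartingales (W := fun t c ↦ W c t)
      (fun c ↦ hWc c) hVc hlaw' hy (hD y hy)

/-- **(J) ∧ (D) ⟹ the subsequential limit is chordal SLE_{16/3}** (for one limit law `μ` and one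
chordal uniformizing map `φ`): `exists_cylinderIdentityData_of_limitData` followed by
`isSLELaw_sixteen_thirds_of_cylinderIdentity`. This is Duminil-Copin–Smirnov's Thm. 6.4 +
Prop. 6.7 (= CDHKS Thm. 2's identification step) with exactly its two quoted inputs as
hypotheses. [cite: CDHKSCRAS2014, Thm. 2 (proof, §3)] [cite: DuminilCopinSmirnov2012Clay, Thm. 6.4 and Prop. 6.7] -/
theorem isSLELaw_sixteen_thirds_of_limitData (hφ : D.IsChordalUniformizing φ)
    (hdesc : ∀ᵐ c ∂μ, IsLoewnerDescribable φ c) (hsrc : ∀ᵐ c ∂μ, c.source = D.pt 0)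
    (hVc : ∀ k ω, Continuous (V k · ω))
    (hlaw : TendstoInDistribution (fun k ω ↦ (⟨fun u ↦ V k u ω, hVc k ω⟩ : C(ℝ≥0, ℝ))) atTop
      (fun c ↦ (⟨drivingFunction φ c, continuous_drivingFunction φ c⟩ : C(ℝ≥0, ℝ))) P μ)
    (htail : ∀ t : ℝ≥0, ∃ (K r : ℝ) (n₀ : ℕ), 0 < r ∧ ∀ n : ℕ, n₀ ≤ n →
      ∀ᶠ k in atTop, P k {ω | ∃ u, u ≤ t ∧ (n : ℝ) < |V k u ω|} ≤
        ENNReal.ofReal (K * Real.exp (-r * n)))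
    (hD : ∀ y : ℝ, 0 < y → ∀ s t : ℝ≥0, s < t → t < cdhksTime y →
      ∃ (C' : ℝ) (ε Δ η : ℕ → ℝ≥0), Tendsto ε atTop (𝓝 0) ∧ Tendsto Δ atTop (𝓝 0) ∧
        Tendsto η atTop (𝓝 0) ∧
        ∀ k, ∃ (𝒢 : Filtration ℕ (mΩ' k)) (F : ℕ → Ω' k → ℂ) (σ τ : Ω' k → WithTop ℕ)
          (hσ : IsStoppingTime 𝒢 σ) (M : ℕ) (bad : Set (Ω' k)),
          IsStoppingTime 𝒢 τ ∧ Martingale F 𝒢 (P k) ∧ σ ≤ τ ∧ (∀ ω, τ ω ≤ M) ∧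
          (∀ u, u ≤ s → Measurable[hσ.measurableSpace] (V k u)) ∧
          (∀ᵐ ω ∂P k, ‖stoppedValue F σ ω‖ ≤ C') ∧ (∀ᵐ ω ∂P k, ‖stoppedValue F τ ω‖ ≤ C') ∧
          MeasurableSet bad ∧ P k bad ≤ η k ∧
          ∀ᵐ ω ∂P k, ω ∉ bad →
            (∃ u ∈ Icc s (s + Δ k), ‖stoppedValue F σ ω - observableProcess (V k) y u ω‖ ≤ ε k) ∧
            (∃ u ∈ Icc t (t + Δ k), ‖stoppedValue F τ ω - observableProcess (V k) y u ω‖ ≤ ε k)) :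
    IsSLELaw (16 / 3) D μ := by
  obtain ⟨W, hW, hWc, hW0, hmom, hdrv, hcyl⟩ :=
    exists_cylinderIdentityData_of_limitData hφ hdesc hsrc hVc hlaw htail hD
  exact isSLELaw_sixteen_thirds_of_cylinderIdentity hφ hW hWc hW0 hmom hdrv hcyl

end LimitData


/-! ### Global forms: (J) ∧ (D) for every limit ⟹ (M5), (L‴), (L) and crit-ising.S17 (FK) -/

/-- **The literal sentence (M5) of CDHKS §3 from the limit data (J) ∧ (D).** Hypothesis: for
every Dobrushin domain `(D; a, b)`, every family of admissible discretisations `E`, every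
subsequential limit law `μ` of the critical FK-Ising interface laws and every chordal uniformizing
map `φ`, the Kemppainen–Smirnov conclusions for `μ` (a.e. describable through `φ`, curves from `a`)
together with discrete driving processes `V^k` on probability spaces `(Ω' k, P k)` (the interfaces
along a subsequence of meshes) converging in distribution to the driving function of `μ`, with
uniform sub-exponential tails of their running maxima, and the discrete observable martingale
data (D) (spelled out; the same hypothesis in all four global theorems). Conclusion: there is a
version `W` of the driving process (strongly measurable coordinates, continuous paths, `W 0 = 0`,
`L³` running maxima, `μ`-a.e. curve driven by `W` through `φ`) such that for every `y > 0` the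
real and imaginary parts of the time-limited FK observable `N^y = observableProcess W y` are
martingales in the natural filtration of `W` — CDHKS 2014, §3: "for any `z ∈ Ω`, the process
`M_t(z)`, `t ≤ T(z)` … is a martingale with respect to the filtration `(ℱ_t)_{t≥0}` generated by
`W_t`" (FK form: Duminil-Copin–Smirnov 2012, p. 29). PROVED: `exists_cylinderIdentityData_of_limitData`
and the monotone-class bridge `martingale_re_im_observableProcess_of_cylinder`
(`FKIsingNaturalMartingale.lean`). [cite: CDHKSCRAS2014, Thm. 3 and §3]
[cite: DuminilCopinSmirnov2012Clay, Lemma 6.6, Thm. 3.15 and proof of Prop. 6.7 (p. 29)] -/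
theorem exists_naturalObservableMartingale_fkInterface_of_limitData
    (h : ∀ (D : DobrushinDomain) (E : ℝ → DiscreteDobrushin), IsDiscretisation D E →
      ∀ (μ : Measure (CurveClass ℂ)) [IsProbabilityMeasure μ],
        IsSubseqLimitLaw (Ωδ := fun _ ↦ BondConfig (Site 2))
          (fun δ ↦ fkInterfaceCurve D (E δ)) (fun δ ↦ fkDobrushinMeasure (E δ)) μ →
        ∀ φ : ConformalEquiv upperHalfPlaneSet D.carrier, D.IsChordalUniformizing φ →
          (∀ᵐ c ∂μ, IsLoewnerDescribable φ c) ∧ (∀ᵐ c ∂μ, c.source = D.pt 0) ∧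
          ∃ (Ω' : ℕ → Type) (mΩ' : ∀ k, MeasurableSpace (Ω' k)) (P : ∀ k, Measure (Ω' k))
            (_ : ∀ k, IsProbabilityMeasure (P k)) (V : ∀ k, ℝ≥0 → Ω' k → ℝ)
            (hVc : ∀ k ω, Continuous (V k · ω)),
            TendstoInDistribution (fun k ω ↦ (⟨fun u ↦ V k u ω, hVc k ω⟩ : C(ℝ≥0, ℝ))) atTop
              (fun c ↦ (⟨drivingFunction φ c, continuous_drivingFunction φ c⟩ : C(ℝ≥0, ℝ))) P μ ∧
            (∀ t : ℝ≥0, ∃ (K r : ℝ) (n₀ : ℕ), 0 < r ∧ ∀ n : ℕ, n₀ ≤ n →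
              ∀ᶠ k in atTop, P k {ω | ∃ u, u ≤ t ∧ (n : ℝ) < |V k u ω|} ≤
                ENNReal.ofReal (K * Real.exp (-r * n))) ∧
            (∀ y : ℝ, 0 < y → ∀ s t : ℝ≥0, s < t → t < cdhksTime y →
              ∃ (C' : ℝ) (ε Δ η : ℕ → ℝ≥0), Tendsto ε atTop (𝓝 0) ∧ Tendsto Δ atTop (𝓝 0) ∧
                Tendsto η atTop (𝓝 0) ∧
                ∀ k, ∃ (𝒢 : Filtration ℕ (mΩ' k)) (F : ℕ → Ω' k → ℂ) (σ τ : Ω' k → WithTop ℕ)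
                  (hσ : IsStoppingTime 𝒢 σ) (M : ℕ) (bad : Set (Ω' k)),
                  IsStoppingTime 𝒢 τ ∧ Martingale F 𝒢 (P k) ∧ σ ≤ τ ∧ (∀ ω, τ ω ≤ M) ∧
                  (∀ u, u ≤ s → Measurable[hσ.measurableSpace] (V k u)) ∧
                  (∀ᵐ ω ∂P k, ‖stoppedValue F σ ω‖ ≤ C') ∧
                  (∀ᵐ ω ∂P k, ‖stoppedValue F τ ω‖ ≤ C') ∧
                  MeasurableSet bad ∧ P k bad ≤ η k ∧
                  ∀ᵐ ω ∂P k, ω ∉ bad →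
                    (∃ u ∈ Icc s (s + Δ k),
                      ‖stoppedValue F σ ω - observableProcess (V k) y u ω‖ ≤ ε k) ∧
                    (∃ u ∈ Icc t (t + Δ k),
                      ‖stoppedValue F τ ω - observableProcess (V k) y u ω‖ ≤ ε k))) :
    ∀ (D : DobrushinDomain) (E : ℝ → DiscreteDobrushin), IsDiscretisation D E →
      ∀ μ : Measure (CurveClass ℂ), IsProbabilityMeasure μ →
        IsSubseqLimitLaw (Ωδ := fun _ ↦ BondConfig (Site 2))
          (fun δ ↦ fkInterfaceCurve D (E δ)) (fun δ ↦ fkDobrushinMeasure (E δ)) μ →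
        ∀ φ : ConformalEquiv upperHalfPlaneSet D.carrier, D.IsChordalUniformizing φ →
          ∃ (W : CurveClass ℂ → ℝ≥0 → ℝ) (hW : ∀ t, StronglyMeasurable (fun c ↦ W c t)),
            (∀ c, Continuous (W c)) ∧ (∀ c, W c 0 = 0) ∧
            (∀ t : ℝ≥0, ∃ M : CurveClass ℂ → ℝ, MemLp M 3 μ ∧ (∀ c, 0 ≤ M c) ∧
              ∀ᵐ c ∂μ, ∀ u, u ≤ t → |W c u| ≤ M c) ∧
            (∀ᵐ c ∂μ, Loewner.IsDrivenBy φ.boundaryExtension (D.pt 1) (W c) c) ∧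
            ∀ y : ℝ, 0 < y →
              Martingale (fun t c ↦ (observableProcess (fun t c ↦ W c t) y t c).re)
                (Filtration.natural (fun t c ↦ W c t) hW) μ ∧
              Martingale (fun t c ↦ (observableProcess (fun t c ↦ W c t) y t c).im)
                (Filtration.natural (fun t c ↦ W c t) hW) μ := by
  intro D E hE μ hμ hlim φ hφ
  haveI := hμ
  obtain ⟨hdesc, hsrc, Ω', mΩ', P, hP, V, hVc, hlaw, htail, hD⟩ := h D E hE μ hlim φ hφ
  obtain ⟨W, hW, hWc, hW0, hmom, hdrv, hcyl⟩ :=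
    exists_cylinderIdentityData_of_limitData hφ hdesc hsrc hVc hlaw htail hD
  exact ⟨W, hW, hWc, hW0, hmom, hdrv, fun y hy ↦
    martingale_re_im_observableProcess_of_cylinder (W := fun t c ↦ W c t) hW hWc hy (hcyl y hy)⟩

/-- **The layer-4 named fact (L‴) from the limit data (J) ∧ (D).** Under the same hypothesis,
`exists_observableMartingale_fkInterface` (`FKIsingObservableMartingale.lean`: for a version `W`
of the driving process of every subsequential limit and some filtration — here the natural
filtration of `W`, level `y₀ = 1` — the FK observable stopped at the far-field stopping time
`τ_y` has martingale real and imaginary parts for all `y ≥ y₀`) holds: natural-filtration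
martingales by `exists_naturalObservableMartingale_fkInterface_of_limitData`, then optional
stopping at `τ_y ≤ (y/128)² ≤ y²/9` (`Loewner.martingale_re_stoppedObservable`,
`Loewner.martingale_im_stoppedObservable`). (Duminil-Copin–Smirnov 2012, p. 29: "`M^δ_{τ_t}(z')`
is a martingale … Since the convergence is uniform, `M_t(z') := lim_{δ→0} M^δ_{τ_t}(z')` is a
martingale"; CDHKS 2014, §3, from the displayed claim to "(5) is a martingale".) PROVED.
[cite: DuminilCopinSmirnov2012Clay, Lemma 6.6, Thm. 6.4 and proof of Prop. 6.7 (p. 29)]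
[cite: CDHKSCRAS2014, Thm. 3 and §3 eq. (5)] -/
theorem exists_observableMartingale_fkInterface_of_limitData
    (h : ∀ (D : DobrushinDomain) (E : ℝ → DiscreteDobrushin), IsDiscretisation D E →
      ∀ (μ : Measure (CurveClass ℂ)) [IsProbabilityMeasure μ],
        IsSubseqLimitLaw (Ωδ := fun _ ↦ BondConfig (Site 2))
          (fun δ ↦ fkInterfaceCurve D (E δ)) (fun δ ↦ fkDobrushinMeasure (E δ)) μ →
        ∀ φ : ConformalEquiv upperHalfPlaneSet D.carrier, D.IsChordalUniformizing φ →
          (∀ᵐ c ∂μ, IsLoewnerDescribable φ c) ∧ (∀ᵐ c ∂μ, c.source = D.pt 0) ∧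
          ∃ (Ω' : ℕ → Type) (mΩ' : ∀ k, MeasurableSpace (Ω' k)) (P : ∀ k, Measure (Ω' k))
            (_ : ∀ k, IsProbabilityMeasure (P k)) (V : ∀ k, ℝ≥0 → Ω' k → ℝ)
            (hVc : ∀ k ω, Continuous (V k · ω)),
            TendstoInDistribution (fun k ω ↦ (⟨fun u ↦ V k u ω, hVc k ω⟩ : C(ℝ≥0, ℝ))) atTop
              (fun c ↦ (⟨drivingFunction φ c, continuous_drivingFunction φ c⟩ : C(ℝ≥0, ℝ))) P μ ∧
            (∀ t : ℝ≥0, ∃ (K r : ℝ) (n₀ : ℕ), 0 < r ∧ ∀ n : ℕ, n₀ ≤ n →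
              ∀ᶠ k in atTop, P k {ω | ∃ u, u ≤ t ∧ (n : ℝ) < |V k u ω|} ≤
                ENNReal.ofReal (K * Real.exp (-r * n))) ∧
            (∀ y : ℝ, 0 < y → ∀ s t : ℝ≥0, s < t → t < cdhksTime y →
              ∃ (C' : ℝ) (ε Δ η : ℕ → ℝ≥0), Tendsto ε atTop (𝓝 0) ∧ Tendsto Δ atTop (𝓝 0) ∧
                Tendsto η atTop (𝓝 0) ∧
                ∀ k, ∃ (𝒢 : Filtration ℕ (mΩ' k)) (F : ℕ → Ω' k → ℂ) (σ τ : Ω' k → WithTop ℕ)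
                  (hσ : IsStoppingTime 𝒢 σ) (M : ℕ) (bad : Set (Ω' k)),
                  IsStoppingTime 𝒢 τ ∧ Martingale F 𝒢 (P k) ∧ σ ≤ τ ∧ (∀ ω, τ ω ≤ M) ∧
                  (∀ u, u ≤ s → Measurable[hσ.measurableSpace] (V k u)) ∧
                  (∀ᵐ ω ∂P k, ‖stoppedValue F σ ω‖ ≤ C') ∧
                  (∀ᵐ ω ∂P k, ‖stoppedValue F τ ω‖ ≤ C') ∧
                  MeasurableSet bad ∧ P k bad ≤ η k ∧
                  ∀ᵐ ω ∂P k, ω ∉ bad →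
                    (∃ u ∈ Icc s (s + Δ k),
                      ‖stoppedValue F σ ω - observableProcess (V k) y u ω‖ ≤ ε k) ∧
                    (∃ u ∈ Icc t (t + Δ k),
                      ‖stoppedValue F τ ω - observableProcess (V k) y u ω‖ ≤ ε k))) :
    exists_observableMartingale_fkInterface := by
  intro D E hE μ hμ hlim φ hφ
  haveI := hμ
  obtain ⟨W, hW, hWc, hW0, hmom, hdrv, hmart⟩ :=
    exists_naturalObservableMartingale_fkInterface_of_limitData h D E hE μ hμ hlim φ hφ
  have hWad : StronglyAdapted (Filtration.natural (fun t c ↦ W c t) hW) (fun t c ↦ W c t) :=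
    Filtration.stronglyAdapted_natural hW
  refine ⟨W, Filtration.natural (fun t c ↦ W c t) hW, 1, hWad, hWc, hW0, hmom, hdrv,
    fun y hy ↦ ?_⟩
  have hy0 : 0 < y := by linarith
  exact ⟨martingale_re_stoppedObservable hWad hWc hy0 (hmart y hy0).1,
    martingale_im_stoppedObservable hWad hWc hy0 (hmart y hy0).2⟩

/-- **(L) from the limit data (J) ∧ (D).** If the Kemppainen–Smirnov conclusions and the discrete
observable martingale data hold for every subsequential limit of the critical FK-Ising interface
laws (hypothesis of `exists_observableMartingale_fkInterface_of_limitData`), then every such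
limit is the chordal SLE_{16/3} law: the named fact (L)
`isSLELaw_of_isSubseqLimitLaw_fkInterfaceCurve` of `FKIsingInterfaceSLE.lean` holds
(`isSLELaw_of_isSubseqLimitLaw_fkInterfaceCurve_of_exists_observableMartingale`,
`FKIsingInterfaceSLEAssembly.lean`: far-field expansion, Lévy, Rohde–Schramm at `κ = 16/3`, all
proved). PROVED. [cite: CDHKSCRAS2014, Thm. 2] [cite: DuminilCopinSmirnov2012Clay, Thm. 6.4 and Prop. 6.7] -/
theorem isSLELaw_of_isSubseqLimitLaw_fkInterfaceCurve_of_limitData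
    (h : ∀ (D : DobrushinDomain) (E : ℝ → DiscreteDobrushin), IsDiscretisation D E →
      ∀ (μ : Measure (CurveClass ℂ)) [IsProbabilityMeasure μ],
        IsSubseqLimitLaw (Ωδ := fun _ ↦ BondConfig (Site 2))
          (fun δ ↦ fkInterfaceCurve D (E δ)) (fun δ ↦ fkDobrushinMeasure (E δ)) μ →
        ∀ φ : ConformalEquiv upperHalfPlaneSet D.carrier, D.IsChordalUniformizing φ →
          (∀ᵐ c ∂μ, IsLoewnerDescribable φ c) ∧ (∀ᵐ c ∂μ, c.source = D.pt 0) ∧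
          ∃ (Ω' : ℕ → Type) (mΩ' : ∀ k, MeasurableSpace (Ω' k)) (P : ∀ k, Measure (Ω' k))
            (_ : ∀ k, IsProbabilityMeasure (P k)) (V : ∀ k, ℝ≥0 → Ω' k → ℝ)
            (hVc : ∀ k ω, Continuous (V k · ω)),
            TendstoInDistribution (fun k ω ↦ (⟨fun u ↦ V k u ω, hVc k ω⟩ : C(ℝ≥0, ℝ))) atTop
              (fun c ↦ (⟨drivingFunction φ c, continuous_drivingFunction φ c⟩ : C(ℝ≥0, ℝ))) P μ ∧
            (∀ t : ℝ≥0, ∃ (K r : ℝ) (n₀ : ℕ), 0 < r ∧ ∀ n : ℕ, n₀ ≤ n →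
              ∀ᶠ k in atTop, P k {ω | ∃ u, u ≤ t ∧ (n : ℝ) < |V k u ω|} ≤
                ENNReal.ofReal (K * Real.exp (-r * n))) ∧
            (∀ y : ℝ, 0 < y → ∀ s t : ℝ≥0, s < t → t < cdhksTime y →
              ∃ (C' : ℝ) (ε Δ η : ℕ → ℝ≥0), Tendsto ε atTop (𝓝 0) ∧ Tendsto Δ atTop (𝓝 0) ∧
                Tendsto η atTop (𝓝 0) ∧
                ∀ k, ∃ (𝒢 : Filtration ℕ (mΩ' k)) (F : ℕ → Ω' k → ℂ) (σ τ : Ω' k → WithTop ℕ)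
                  (hσ : IsStoppingTime 𝒢 σ) (M : ℕ) (bad : Set (Ω' k)),
                  IsStoppingTime 𝒢 τ ∧ Martingale F 𝒢 (P k) ∧ σ ≤ τ ∧ (∀ ω, τ ω ≤ M) ∧
                  (∀ u, u ≤ s → Measurable[hσ.measurableSpace] (V k u)) ∧
                  (∀ᵐ ω ∂P k, ‖stoppedValue F σ ω‖ ≤ C') ∧
                  (∀ᵐ ω ∂P k, ‖stoppedValue F τ ω‖ ≤ C') ∧
                  MeasurableSet bad ∧ P k bad ≤ η k ∧
                  ∀ᵐ ω ∂P k, ω ∉ bad →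
                    (∃ u ∈ Icc s (s + Δ k),
                      ‖stoppedValue F σ ω - observableProcess (V k) y u ω‖ ≤ ε k) ∧
                    (∃ u ∈ Icc t (t + Δ k),
                      ‖stoppedValue F τ ω - observableProcess (V k) y u ω‖ ≤ ε k))) :
    isSLELaw_of_isSubseqLimitLaw_fkInterfaceCurve :=
  isSLELaw_of_isSubseqLimitLaw_fkInterfaceCurve_of_exists_observableMartingale
    (exists_observableMartingale_fkInterface_of_limitData h)

/-- **Crit-ising.S17 (FK) from the traversal bound (C1) and the limit data (J) ∧ (D).** CDHKS
Theorem 2 — convergence in law of the critical FK-Ising Dobrushin interfaces of a discretised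
Dobrushin domain to chordal SLE_{16/3}, `convergesInLawToSLE_sixteen_thirds_fkInterface` — follows
from the FK traversal bound (C1) `fkInterface_traversalBound` (Duminil-Copin–Smirnov 2012, proof
of Thm. 6.1, eq. (6.2): tightness) and the limit data (J) ∧ (D) above (Kemppainen–Smirnov's
theorem for the FK family; the discrete observable martingales with Smirnov's convergence
theorem): (L) by `isSLELaw_of_isSubseqLimitLaw_fkInterfaceCurve_of_limitData`, then the layer-1
assembly `convergesInLawToSLE_sixteen_thirds_fkInterface_of_traversalBound` with uniqueness in
law of chordal SLE (`IsSLECurve.map_eq_holds`, proved). This is the named-fact-free frontier of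
crit-ising.S17 (FK): one named fact, (C1), and the two printed inputs of CDHKS §3 as hypotheses.
PROVED. [cite: CDHKSCRAS2014, Thm. 2] [cite: DuminilCopinSmirnov2012Clay, Thm. 6.1, Thm. 6.4 and Prop. 6.7] -/
theorem convergesInLawToSLE_sixteen_thirds_fkInterface_of_traversalBound_of_limitData
    (h1 : fkInterface_traversalBound)
    (h : ∀ (D : DobrushinDomain) (E : ℝ → DiscreteDobrushin), IsDiscretisation D E →
      ∀ (μ : Measure (CurveClass ℂ)) [IsProbabilityMeasure μ],
        IsSubseqLimitLaw (Ωδ := fun _ ↦ BondConfig (Site 2))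
          (fun δ ↦ fkInterfaceCurve D (E δ)) (fun δ ↦ fkDobrushinMeasure (E δ)) μ →
        ∀ φ : ConformalEquiv upperHalfPlaneSet D.carrier, D.IsChordalUniformizing φ →
          (∀ᵐ c ∂μ, IsLoewnerDescribable φ c) ∧ (∀ᵐ c ∂μ, c.source = D.pt 0) ∧
          ∃ (Ω' : ℕ → Type) (mΩ' : ∀ k, MeasurableSpace (Ω' k)) (P : ∀ k, Measure (Ω' k))
            (_ : ∀ k, IsProbabilityMeasure (P k)) (V : ∀ k, ℝ≥0 → Ω' k → ℝ)
            (hVc : ∀ k ω, Continuous (V k · ω)),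
            TendstoInDistribution (fun k ω ↦ (⟨fun u ↦ V k u ω, hVc k ω⟩ : C(ℝ≥0, ℝ))) atTop
              (fun c ↦ (⟨drivingFunction φ c, continuous_drivingFunction φ c⟩ : C(ℝ≥0, ℝ))) P μ ∧
            (∀ t : ℝ≥0, ∃ (K r : ℝ) (n₀ : ℕ), 0 < r ∧ ∀ n : ℕ, n₀ ≤ n →
              ∀ᶠ k in atTop, P k {ω | ∃ u, u ≤ t ∧ (n : ℝ) < |V k u ω|} ≤
                ENNReal.ofReal (K * Real.exp (-r * n))) ∧
            (∀ y : ℝ, 0 < y → ∀ s t : ℝ≥0, s < t → t < cdhksTime y →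
              ∃ (C' : ℝ) (ε Δ η : ℕ → ℝ≥0), Tendsto ε atTop (𝓝 0) ∧ Tendsto Δ atTop (𝓝 0) ∧
                Tendsto η atTop (𝓝 0) ∧
                ∀ k, ∃ (𝒢 : Filtration ℕ (mΩ' k)) (F : ℕ → Ω' k → ℂ) (σ τ : Ω' k → WithTop ℕ)
                  (hσ : IsStoppingTime 𝒢 σ) (M : ℕ) (bad : Set (Ω' k)),
                  IsStoppingTime 𝒢 τ ∧ Martingale F 𝒢 (P k) ∧ σ ≤ τ ∧ (∀ ω, τ ω ≤ M) ∧
                  (∀ u, u ≤ s → Measurable[hσ.measurableSpace] (V k u)) ∧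
                  (∀ᵐ ω ∂P k, ‖stoppedValue F σ ω‖ ≤ C') ∧
                  (∀ᵐ ω ∂P k, ‖stoppedValue F τ ω‖ ≤ C') ∧
                  MeasurableSet bad ∧ P k bad ≤ η k ∧
                  ∀ᵐ ω ∂P k, ω ∉ bad →
                    (∃ u ∈ Icc s (s + Δ k),
                      ‖stoppedValue F σ ω - observableProcess (V k) y u ω‖ ≤ ε k) ∧
                    (∃ u ∈ Icc t (t + Δ k),
                      ‖stoppedValue F τ ω - observableProcess (V k) y u ω‖ ≤ ε k))) :
    convergesInLawToSLE_sixteen_thirds_fkInterface :=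
  convergesInLawToSLE_sixteen_thirds_fkInterface_of_traversalBound
    RandomPlanarGeometry.IsSLECurve.map_eq_holds h1
    (isSLELaw_of_isSubseqLimitLaw_fkInterfaceCurve_of_limitData h)

end Literature.Probability.LatticeModels
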